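import Summits.KontsevichZagierPeriods.KontsevichZagierPeriods.Theorems.LinRedNormalFormArrangementNormalFormSeparateThreeHIPieces
import Summits.KontsevichZagierPeriods.KontsevichZagierPeriods.Theorems.LinRedNormalFormArrangementNormalFormSeparateThreeHIScaling

/-!
# Uniform lower bound of the letter block, and the dyadic dilates argument

(Line `janus-bands`, crux `ArrangementNormalForm`, stub `stub_separateThreeZero`, part `HILetters` of
the termwise numerator split `separateThree_hI` under the rim condition.)

Two tools for the lower power bound at a rim vertex (part `HILower`): the lower bound
`cW ‖u‖^E ≤ |Wt(v₀ + u)|` of the letter block on transversal displacements, with a radius that does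
NOT depend on the transversality constant (`Wt_lower_unif`, registered as `separateThree_letters`);
and the DYADIC DILATES ARGUMENT (`false_of_dilates_lower_bound`): a set `S₁` whose pole
coordinate lies in `[3τ/4, 5τ/4]` has pairwise disjoint dyadic dilates `2^{-k} S₁`; if they all
lie in a set on which `G` is integrable, the integrals `∫_{2^{-k} S₁} |G|` cannot be bounded below
by a positive constant.
-/

noncomputable section

open Set MeasureTheory Filter Topology
open scoped ENNReal Pointwise

namespace Summit.KontsevichZagierPeriods.ArrangementNormalForm.JanusBands

namespace SepThree

section Letters

variable {m : ℕ} (κ : Fin m → Fin 2 → ℝ) (μ : Fin m → ℝ) (e : Fin m → ℕ) (v₀ : Fin 2 → ℝ)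

/-- The linear part of a letter scales. -/
theorem klin_smul (j : Fin m) (s : ℝ) (u : Fin 2 → ℝ) :
    κ j 0 * (s • u) 0 + κ j 1 * (s • u) 1 = s * (κ j 0 * u 0 + κ j 1 * u 1) := by
  simp only [Pi.smul_apply, smul_eq_mul]; ring

/-- **Uniform lower bound of the letter block**: the radius in `Wt_lower` does not depend on the
transversality constant. -/
theorem Wt_lower_unif : ∃ δ > 0, ∀ c : ℝ, 0 < c → ∃ cW > 0, ∀ u : Fin 2 → ℝ, ‖u‖ < δ →
    (∀ j, lval κ μ j v₀ = 0 → e j ≠ 0 → c * ‖u‖ ≤ |κ j 0 * u 0 + κ j 1 * u 1|) →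
    cW * ‖u‖ ^ Eord κ μ e v₀ ≤ |Wt κ μ e (v₀ + u)| := by
  classical
  set K : Fin m → ℝ := fun j => |κ j 0| + |κ j 1| + 1 with hK
  have hK0 : ∀ j, 0 < K j := fun j => by simp only [hK]; positivity
  set δ' : Fin m → ℝ := fun j => if lval κ μ j v₀ = 0 then 1 else |lval κ μ j v₀| / (2 * K j) with hδ'
  have hδ'0 : ∀ j, 0 < δ' j := fun j => by
    simp only [hδ']; split_ifs with h
    · exact one_pos
    · exact div_pos (abs_pos.2 h) (by linarith [hK0 j])
  obtain ⟨δ, hδ0, hδ⟩ := exists_pos_le_all δ' hδ'0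
  refine ⟨δ, hδ0, fun c hc => ?_⟩
  set lo : Fin m → ℝ := fun j => if lval κ μ j v₀ = 0 then (if e j = 0 then 1 else c)
    else |lval κ μ j v₀| / 2 with hlo
  have hlo0 : ∀ j, 0 < lo j := fun j => by
    simp only [hlo]; split_ifs with h h'
    · exact one_pos
    · exact hc
    · exact half_pos (abs_pos.2 h)
  refine ⟨∏ j, lo j ^ e j, Finset.prod_pos fun j _ => pow_pos (hlo0 j) _, fun u hu htr => ?_⟩
  have hfac : ∀ j, (lo j * (if lval κ μ j v₀ = 0 then ‖u‖ else 1)) ^ e j ≤ |lval κ μ j (v₀ + u)| ^ e j := by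
    intro j
    by_cases hj : lval κ μ j v₀ = 0
    · by_cases hej : e j = 0
      · simp [hej]
      · refine pow_le_pow_left₀ (by positivity) ?_ _
        simp only [hlo, if_pos hj, if_neg hej]
        rw [lval_add, hj, zero_add]
        exact htr j hj hej
    · refine pow_le_pow_left₀ (by positivity) ?_ _
      simp only [hlo, if_neg hj, mul_one]
      have huj : ‖u‖ < |lval κ μ j v₀| / (2 * K j) := by
        have := hδ j; simp only [hδ', if_neg hj] at this; exact hu.trans_le this
      rw [lval_add]
      have h1 := abs_klin_le κ j u
      have h2 : (|κ j 0| + |κ j 1|) * ‖u‖ ≤ K j * ‖u‖ :=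
        mul_le_mul_of_nonneg_right (by simp only [hK]; linarith) (norm_nonneg _)
      have h3 : K j * ‖u‖ < |lval κ μ j v₀| / 2 := by
        have h5 := mul_lt_mul_of_pos_left huj (hK0 j)
        have hKj := (hK0 j).ne'
        have h6 : K j * (|lval κ μ j v₀| / (2 * K j)) = |lval κ μ j v₀| / 2 := by
          field_simp
        linarith
      have h4 := abs_sub_abs_le_abs_sub (lval κ μ j v₀) (-(κ j 0 * u 0 + κ j 1 * u 1))
      rw [abs_neg, sub_neg_eq_add] at h4
      linarith
  unfold Wt Eord
  rw [Finset.abs_prod]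
  calc (∏ j, lo j ^ e j) * ‖u‖ ^ ∑ j ∈ Finset.univ.filter (fun j => lval κ μ j v₀ = 0), e j
      = ∏ j, (lo j * (if lval κ μ j v₀ = 0 then ‖u‖ else 1)) ^ e j := by
        rw [← Finset.prod_pow_eq_pow_sum, Finset.prod_filter, ← Finset.prod_mul_distrib]
        refine Finset.prod_congr rfl fun j _ => ?_
        split_ifs with h
        · rw [mul_pow]
        · rw [mul_one, mul_one]
    _ ≤ ∏ j, |lval κ μ j (v₀ + u)| ^ e j :=
        Finset.prod_le_prod (fun j _ => by positivity) fun j _ => hfac j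
    _ = ∏ j, |lval κ μ j (v₀ + u) ^ e j| := Finset.prod_congr rfl fun j _ => (abs_pow _ _).symm

end Letters

/-! ### The dyadic dilates argument -/

/-- **The dyadic dilates argument.** See the module docstring. -/
theorem false_of_dilates_lower_bound {S₁ Ω₀ : Set ((Fin 2 → ℝ) × ℝ)} (hS₁m : MeasurableSet S₁)
    {τ : ℝ} (hτ : 0 < τ) (hS₁t : ∀ p ∈ S₁, 3 * τ / 4 ≤ p.2 ∧ p.2 ≤ 5 * τ / 4)
    {G : (Fin 2 → ℝ) × ℝ → ℝ} (hG : IntegrableOn G Ω₀)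
    (hsub : ∀ s : ℝ, 0 < s → s ≤ 1 → ∀ p ∈ S₁, s • p ∈ Ω₀)
    {κ₀ : ℝ} (hκ₀0 : 0 < κ₀) (hbox : ∀ s : ℝ, 0 < s → s ≤ 1 → κ₀ ≤ ∫ p in s • S₁, |G p|) : False := by
  -- the dyadic dilates are pairwise disjoint
  set lam : ℕ → ℝ := fun k => (1 / 2 : ℝ) ^ k with hlam
  have hlam0 : ∀ k, 0 < lam k := fun k => pow_pos one_half_pos k
  have hlam1 : ∀ k, lam k ≤ 1 := fun k => pow_le_one₀ one_half_pos.le (by norm_num)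
  have hdisj : Pairwise (Function.onFun Disjoint fun k => lam k • S₁) := by
    have hsep : ∀ k l, k < l → Disjoint (lam k • S₁) (lam l • S₁) := by
      intro k l hkl
      rw [Set.disjoint_left]
      rintro p ⟨p₁, hp₁, rfl⟩ ⟨p₂, hp₂, heq⟩
      have h1 := hS₁t p₁ hp₁
      have h2 := hS₁t p₂ hp₂
      have he2 : lam l * p₂.2 = lam k * p₁.2 := congrArg Prod.snd heq
      have hll : lam l ≤ lam k / 2 := by
        have hle : (1 / 2 : ℝ) ^ l ≤ (1 / 2) ^ (k + 1) :=
          pow_le_pow_of_le_one (by norm_num) (by norm_num) (Nat.succ_le_of_lt hkl)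
        show (1 / 2 : ℝ) ^ l ≤ (1 / 2 : ℝ) ^ k / 2
        calc (1 / 2 : ℝ) ^ l ≤ (1 / 2) ^ (k + 1) := hle
          _ = (1 / 2 : ℝ) ^ k / 2 := by rw [pow_succ]; ring
      have hA : lam k * (3 * τ / 4) ≤ lam k * p₁.2 := mul_le_mul_of_nonneg_left h1.1 (hlam0 k).le
      have hB' : lam l * p₂.2 ≤ (lam k / 2) * (5 * τ / 4) :=
        mul_le_mul hll h2.2 (by linarith [h2.1]) (by linarith [hlam0 k])
      have hpos' := mul_pos (hlam0 k) hτ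
      linarith
    intro k l hkl
    rcases lt_or_gt_of_ne hkl with h | h
    · exact hsep k l h
    · exact (hsep l k h).symm
  -- summing over the first `K` dilates contradicts integrability
  have hGabs : IntegrableOn (fun p => |G p|) Ω₀ := hG.abs
  set Itot : ℝ := ∫ p in Ω₀, |G p| with hItot
  have hsum : ∀ K : ℕ, (K : ℝ) * κ₀ ≤ Itot := by
    intro K
    have hmeas : ∀ k ∈ Finset.range K, MeasurableSet (lam k • S₁) := fun k _ =>
      hS₁m.const_smul₀ (lam k)
    have hdisj' : Set.PairwiseDisjoint (↑(Finset.range K) : Set ℕ) fun k => lam k • S₁ :=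
      fun k _ l _ hkl => hdisj hkl
    have hsub' : (⋃ k ∈ Finset.range K, lam k • S₁) ⊆ Ω₀ := by
      intro p hp
      simp only [mem_iUnion] at hp
      obtain ⟨k, -, p₁, hp₁, rfl⟩ := hp
      exact hsub (lam k) (hlam0 k) (hlam1 k) p₁ hp₁
    calc (K : ℝ) * κ₀ = ∑ _k ∈ Finset.range K, κ₀ := by simp
      _ ≤ ∑ k ∈ Finset.range K, ∫ p in lam k • S₁, |G p| :=
          Finset.sum_le_sum fun k _ => hbox (lam k) (hlam0 k) (hlam1 k)
      _ = ∫ p in ⋃ k ∈ Finset.range K, lam k • S₁, |G p| :=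
          (integral_biUnion_finset _ hmeas hdisj' fun k _ => (hGabs.mono_set (by
            rintro p ⟨p₁, hp₁, rfl⟩; exact hsub (lam k) (hlam0 k) (hlam1 k) p₁ hp₁))).symm
      _ ≤ Itot := setIntegral_mono_set hGabs (ae_of_all _ fun _ => abs_nonneg _) (ae_of_all _ hsub')
  obtain ⟨K, hK⟩ := exists_nat_gt (Itot / κ₀)
  have := hsum K
  rw [div_lt_iff₀ hκ₀0] at hK
  linarith


end SepThree

/-- **Uniform lower bound of the letter block** (registered part of `stub_separateThreeZero`;
literal form of `SepThree.Wt_lower_unif`): there is a radius `δ > 0` such that for every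
transversality constant `c > 0` some `cW > 0` satisfies `cW ‖u‖^E ≤ |Wt(v₀ + u)|` for all
`‖u‖ < δ` with `c ‖u‖ ≤ |κⱼ · u|` for the letters `j` through `v₀` of non-zero exponent (`E` the
order of the letter block at `v₀`). -/
theorem separateThree_letters {m : ℕ} (κ : Fin m → Fin 2 → ℝ) (μ : Fin m → ℝ) (e : Fin m → ℕ) (v₀ : Fin 2 → ℝ) : ∃ δ > 0, ∀ c : ℝ, 0 < c → ∃ cW > 0, ∀ u : Fin 2 → ℝ, ‖u‖ < δ → (∀ j, SepThree.lval κ μ j v₀ = 0 → e j ≠ 0 → c * ‖u‖ ≤ |κ j 0 * u 0 + κ j 1 * u 1|) → cW * ‖u‖ ^ SepThree.Eord κ μ e v₀ ≤ |SepThree.Wt κ μ e (v₀ + u)| := by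
  exact SepThree.Wt_lower_unif κ μ e v₀

end Summit.KontsevichZagierPeriods.ArrangementNormalForm.JanusBands
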